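import Summits.MatrixMultiplication.OmegaCensus.ZetaBlocks

/-!
# ω-census, family (b3): conjecture C9 — `(ℤ[ζ₅]/p) ⋊ C₅`: the `p`-INDEPENDENT decidable check and the generic theorem

HONEST FRAMING (pub-omega census; verbatim): lottery ticket; floor = certified bounds/negative ranges.
Census BOOKKEEPING (conjecture C9 of the cell; pub-omega stpp-1 gen 22).  Vocabulary: `ZetaCyclic.lean`, `ZetaBlocks.lean`.
Box `Y = {1, a^α, b}`, `W = {1, a^β, b^t}` with `α = A/2`, `β = B/2` for coordinate vectors `A, B ∈ ℤ⁴`: every coordinate of every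
product `ζ^s α`, `ζ^s β` is `g/2` with an explicit integer `g` (`gZ`), so its ERROR is exactly `g` and its PHASE is `≡ g (mod 2)`
(`two_val_div`, `phase_residue2`) for every odd `p`.  The coefficient vector of a column pair is `coef = lin t (gZ A) (gZ B) ∈ ℤ⁴`
(`GoldArcs.lin`), giving in coordinate `k` the exact error `E_k = cmp k coef` and `Φ_k ≡ E_k (mod 2)`.  `ZData` / **`ZData.OK Emax`**
(decidable, NO dependence on `p`): small nonzero `A, B`, `t ≠ 0`, phase vectors in `{0,1}⁴`, `|E_k| ≤ Emax`, and for every pair of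
columns / phase vectors some coordinate passing `OK2` (parity + the two one-sided trim clauses).  **`exists_indep`**: `OK Emax` and
`2·Emax < p` give a nondegenerate box whose 4-D arc set is independent; **`not_boxUseful_of_count`** (exact count, decidable per
`p`) and **`not_boxUseful_of_unif`** (`144 p⁴ ≤ 5·MIS·(p − 5)⁴` when all trims are `≤ 4` per coordinate).  Data and theorems:
`ZetaAll.lean`.  Nothing here is progress on `ω`.
-/

namespace Summit.MatrixMultiplication.OmegaCensus

open Finset

namespace ZetaArcs

open GoldArcs (col lin map_lin)
open EisArcs (PhiR)

/-! ### Coefficient vectors and the check -/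

/-- Coordinate vectors of `ζ^s · V`. [folklore] -/
def gZ (V : ℤ × ℤ × ℤ × ℤ) : ZMod 5 → ℤ × ℤ × ℤ × ℤ := fun s => lzpow4 s.val V

/-- The coefficient vector of the column pair `(c, c')`: exact errors `E_k`, phases `≡ E_k (mod 2)`. [folklore] -/
def coef (A B : ℤ × ℤ × ℤ × ℤ) (t : ZMod 5) (c c' : Fin 3 × Fin 3) : ℤ × ℤ × ℤ × ℤ := lin t (gZ A) (gZ B) c c'

/-- The `k`-th component as an additive map. [folklore] -/
def cmpHom (k : Fin 4) : (ℤ × ℤ × ℤ × ℤ) →+ ℤ where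
  toFun := cmp k
  map_zero' := by fin_cases k <;> rfl
  map_add' v w := by fin_cases k <;> rfl

/-- One coordinate of the check: parity and the two one-sided trim clauses (the error `E` is exact, so is its sign). [folklore] -/
def OK2 (E φ φ' : ℤ) (l h l' h' : ℕ) : Prop :=
  (φ - φ' - E) % 2 ≠ 0 ∧ (0 < E → E ≤ h' ∨ E ≤ l) ∧ (E < 0 → -E ≤ l' ∨ -E ≤ h)

/-- `OK2` is decidable. [folklore] -/
instance (E φ φ' : ℤ) (l h l' h' : ℕ) : Decidable (OK2 E φ φ' l h l' h') := by unfold OK2; infer_instance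

/-- A coordinate vector is *small nonzero*: some nonzero component, all components in `[−2, 2]`. [folklore] -/
def SmallNZ (v : ℤ × ℤ × ℤ × ℤ) : Prop := (∃ k, cmp k v ≠ 0) ∧ ∀ k, |cmp k v| ≤ 2

/-- `SmallNZ` is decidable. [folklore] -/
instance (v : ℤ × ℤ × ℤ × ℤ) : Decidable (SmallNZ v) := by unfold SmallNZ; infer_instance

/-- The datum: box `(A, B, t)`, phase vectors per column, trims. [folklore] -/
structure ZData where
  /-- coordinates of `2α` -/
  A : ℤ × ℤ × ℤ × ℤ
  /-- coordinates of `2β` -/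
  B : ℤ × ℤ × ℤ × ℤ
  /-- the `b`-exponent of the third `W`-element -/
  t : ZMod 5
  /-- phase vectors (in `{0,1}⁴`) used per column -/
  P : Fin 3 × Fin 3 → Finset (ℤ × ℤ × ℤ × ℤ)
  /-- bottom trims -/
  lo : Fin 3 × Fin 3 → ℤ × ℤ × ℤ × ℤ → ℕ × ℕ × ℕ × ℕ
  /-- top trims -/
  hi : Fin 3 × Fin 3 → ℤ × ℤ × ℤ × ℤ → ℕ × ℕ × ℕ × ℕ

namespace ZData

variable (zd : ZData)

/-- Number of blocks. [folklore] -/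
def MIS : ℕ := ∑ c, #(zd.P c)

/-- The exact cell count at the prime `p`. [folklore] -/
def count (p : ℕ) : ℕ := ∑ c, ∑ φ ∈ zd.P c, blkCount p φ (zd.lo c φ) (zd.hi c φ)

/-- **The check** (independent of `p`): nondegeneracy data, phase vectors in `{0,1}⁴`, error bound `Emax`, and the pair condition in
some coordinate for every ordered pair of distinct columns and phase vectors. [folklore] -/
def OK (Emax : ℕ) : Prop :=
  SmallNZ zd.A ∧ SmallNZ zd.B ∧ zd.t ≠ 0 ∧ (∀ c, ∀ φ ∈ zd.P c, ∀ k, 0 ≤ cmp k φ ∧ cmp k φ < 2) ∧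
    (∀ c c', c ≠ c' → ∀ k, |cmp k (coef zd.A zd.B zd.t c c')| ≤ Emax) ∧
    (∀ c c', c ≠ c' → ∀ φ ∈ zd.P c, ∀ φ' ∈ zd.P c', ∃ k : Fin 4,
      OK2 (cmp k (coef zd.A zd.B zd.t c c')) (cmp k φ) (cmp k φ') (cmp k (zd.lo c φ)) (cmp k (zd.hi c φ))
        (cmp k (zd.lo c' φ')) (cmp k (zd.hi c' φ')))

/-- The check is decidable. [folklore] -/
instance (Emax : ℕ) : Decidable (zd.OK Emax) := by unfold OK; infer_instance

end ZData

/-! ### Arithmetic: halves, phases, residues -/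

variable {p : ℕ}

/-- An element `g/2` of `𝔽_p` has `2·val = a p + g` with an integer phase `a`. [folklore] -/
theorem two_val_div [Fact p.Prime] (h2 : (2 : ZMod p) ≠ 0) (g : ℤ) :
    ∃ a : ℤ, 2 * ((((g : ZMod p) * (2 : ZMod p)⁻¹).val : ℕ) : ℤ) = a * p + g := by
  have hdvd : (p : ℤ) ∣ 2 * ((((g : ZMod p) * (2 : ZMod p)⁻¹).val : ℕ) : ℤ) - g := by
    rw [← ZMod.intCast_zmod_eq_zero_iff_dvd]
    push_cast
    rw [ZMod.natCast_val, ZMod.cast_id', id_eq, mul_comm, mul_assoc, inv_mul_cancel₀ h2, mul_one, sub_self]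
  exact ⟨(2 * ((((g : ZMod p) * (2 : ZMod p)⁻¹).val : ℕ) : ℤ) - g) / p, by rw [Int.ediv_mul_cancel hdvd]; ring⟩

/-- Residue of the phase: `2V = a q + g` with `q` odd forces `a ≡ g (mod 2)`. [folklore] -/
theorem phase_residue2 {a g V : ℤ} {q : ℕ} (hq : Odd q) (h : 2 * V = a * q + g) : ((a : ℤ) : ZMod 2) = g := by
  obtain ⟨k, hk⟩ := hq
  have h1 : a * (q : ℤ) = 2 * (a * k) + a := by rw [hk]; push_cast; ring
  have h2 : (2 : ℤ) ∣ a - g := ⟨V - a * k - g, by linarith⟩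
  have := (ZMod.intCast_eq_intCast_iff_dvd_sub g a 2).2 (by exact_mod_cast h2)
  exact this.symm

/-- Coordinates of `toZ`. [folklore] -/
theorem co_toZ (ι : ZMod p) (k : Fin 4) (v : ℤ × ℤ × ℤ × ℤ) : co k (toZ ι v) = ((cmp k v : ℤ) : ZMod p) * ι := by
  fin_cases k <;> rfl

/-- Coordinates of `0`. [folklore] -/
theorem co_zero (k : Fin 4) : co k (0 : ZetaRing p) = 0 := by
  fin_cases k <;> rfl

/-! ### The generic theorem -/

/-- **Independence.** A passed check with `2·Emax < p` (`p` an odd prime) gives a nondegenerate box of `(ℤ[ζ₅]/p) ⋊ ℤ/5` whose 4-D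
arc set is an independent pattern. [folklore] -/
theorem exists_indep [Fact p.Prime] (hp : 3 ≤ p) (zd : ZData) {Emax : ℕ} (hok : zd.OK Emax) (hE : 2 * Emax < p) :
    haveI : NeZero p := ⟨(Fact.out : p.Prime).ne_zero⟩
    ∃ D : RCyc.RBox (ZetaRing p) 5, D.Nondeg QGold.gz ∧ D.PatIndep QGold.gz (blockArcSet p zd.P zd.lo zd.hi) := by
  have hprime : p.Prime := Fact.out
  haveI : NeZero p := ⟨hprime.ne_zero⟩
  obtain ⟨A, B, t, P, lo, hi⟩ := zd
  obtain ⟨hA, hB, ht, hP, hEm, hpair⟩ := hok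
  dsimp only at hA hB ht hP hEm hpair ⊢
  have hodd : Odd p := hprime.odd_of_ne_two (by omega)
  have h2 : (2 : ZMod p) ≠ 0 := by
    intro h
    have h' : ((2 : ℕ) : ZMod p) = 0 := by exact_mod_cast h
    rw [ZMod.natCast_eq_zero_iff] at h'
    have := Nat.le_of_dvd two_pos h'
    omega
  set ι : ZMod p := (2 : ZMod p)⁻¹ with hι
  have hι0 : ι ≠ 0 := inv_ne_zero h2
  -- the box
  set D : RCyc.RBox (ZetaRing p) 5 := ⟨![0, toZ ι A, 0], ![0, 0, 1], ![0, toZ ι B, 0], ![0, 0, t]⟩ with hD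
  -- phases and errors per coordinate
  choose a ha using fun (V : ℤ × ℤ × ℤ × ℤ) (k : Fin 4) (s : ZMod 5) => two_val_div h2 (cmp k (gZ V s))
  set e : (ℤ × ℤ × ℤ × ℤ) → Fin 4 → ZMod 5 → ℤ := fun V k s => cmp k (gZ V s) with he
  have hcoord : ∀ V k s, 2 * ((co k (RCyc.act QGold.gz s * toZ ι V)).val : ℤ) = a V k s * p + e V k s := by
    intro V k s
    rw [act_gz_toZ, co_toZ]
    exact ha V k s
  have hα : ∀ k s i, 2 * ((co k (RCyc.act QGold.gz s * D.α i)).val : ℤ) = col (a A k) s i * p + col (e A k) s i := by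
    intro k s i
    fin_cases i
    · simp [hD, col, co_zero]
    · simpa [hD, col] using hcoord A k s
    · simp [hD, col, co_zero]
  have hβ : ∀ k s j, 2 * ((co k (RCyc.act QGold.gz s * D.β j)).val : ℤ) = col (a B k) s j * p + col (e B k) s j := by
    intro k s j
    fin_cases j
    · simp [hD, col, co_zero]
    · simpa [hD, col] using hcoord B k s
    · simp [hD, col, co_zero]
  have hPhi : ∀ (u v : ZMod 5 → ℤ) (c c' : Fin 3 × Fin 3), PhiR D (col u) (col v) c c' = lin t u v c c' := by
    intro u v c c'; rfl
  -- `Φ_k ≡ E_k (mod 2)` and `E_k = cmp k coef`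
  have hres : ∀ V k s, ((a V k s : ℤ) : ZMod 2) = ((e V k s : ℤ) : ZMod 2) := fun V k s => phase_residue2 hodd (ha V k s)
  have hmod : ∀ k c c', ((lin t (a A k) (a B k) c c' : ℤ) : ZMod 2) = ((lin t (e A k) (e B k) c c' : ℤ) : ZMod 2) := by
    intro k c c'
    have h1 := map_lin (Int.castAddHom (ZMod 2)) t (a A k) (a B k) c c'
    have h2 := map_lin (Int.castAddHom (ZMod 2)) t (e A k) (e B k) c c'
    simp only [Int.coe_castAddHom] at h1 h2
    rw [h1, h2]
    congr 1 <;> funext s <;> simp only [Function.comp_apply, hres]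
  have herr : ∀ k c c', lin t (e A k) (e B k) c c' = cmp k (coef A B t c c') := by
    intro k c c'
    have := map_lin (cmpHom k) t (gZ A) (gZ B) c c'
    rw [coef, show cmp k (lin t (gZ A) (gZ B) c c') = cmpHom k (lin t (gZ A) (gZ B) c c') from rfl, this]
    rfl
  have hpar : ∀ k c c', (lin t (a A k) (a B k) c c' - cmp k (coef A B t c c')) % 2 = 0 := by
    intro k c c'
    rw [← herr]
    have h := (ZMod.intCast_eq_intCast_iff_dvd_sub _ _ 2).1 (hmod k c c').symm
    exact Int.emod_eq_zero_of_dvd (by exact_mod_cast h)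
  -- the pair condition
  have hcond : ∀ c c', c ≠ c' → ∀ φ ∈ P c, ∀ φ' ∈ P c', ∃ k : Fin 4,
      PairOK2 p (PhiR D (col (a A k)) (col (a B k)) c c') (PhiR D (col (e A k)) (col (e B k)) c c') (cmp k φ) (cmp k φ')
        ((cmp k (lo c φ) : ℕ) : ℤ) ((cmp k (hi c φ) : ℕ) : ℤ) ((cmp k (lo c' φ') : ℕ) : ℤ) ((cmp k (hi c' φ') : ℕ) : ℤ) := by
    intro c c' hcc φ hφ φ' hφ'
    obtain ⟨k, h0, hplus, hminus⟩ := hpair c c' hcc φ hφ φ' hφ'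
    refine ⟨k, ?_, ?_, ?_, ?_⟩
    · rw [hPhi, herr]
      have h1 := hEm c c' hcc k
      have h2 : (Emax : ℤ) * 2 < p := by exact_mod_cast (by omega : Emax * 2 < p)
      linarith [abs_nonneg (cmp k (coef A B t c c'))]
    · rw [hPhi]
      intro h; apply h0
      have := hpar k c c'
      omega
    · rw [hPhi, herr]
      intro hpos
      rcases hplus hpos with h | h
      · exact Or.inl (by exact_mod_cast h)
      · exact Or.inr (by exact_mod_cast h)
    · rw [hPhi, herr]
      intro hneg
      rcases hminus hneg with h | h
      · exact Or.inl (by exact_mod_cast h)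
      · exact Or.inr (by exact_mod_cast h)
  -- independence
  have indep : D.PatIndep QGold.gz (blockArcSet p P lo hi) :=
    (patIndep_blockCells D (fun k => col (a A k)) (fun k => col (e A k)) (fun k => col (a B k)) (fun k => col (e B k))
      hα hβ P lo hi hcond).anti (blockArcSet_subset hP)
  -- nondegeneracy
  have hnz : ∀ {V : ℤ × ℤ × ℤ × ℤ}, SmallNZ V → toZ ι V ≠ (0 : ZetaRing p) := by
    rintro V ⟨⟨k, hk⟩, hsmall⟩ h0
    have h1 : co k (toZ ι V) = co k 0 := by rw [h0]
    rw [co_toZ, co_zero, mul_eq_zero] at h1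
    rcases h1 with h1 | h1
    · rw [ZMod.intCast_zmod_eq_zero_iff_dvd] at h1
      have hle := Int.le_of_dvd (abs_pos.2 hk) ((dvd_abs _ _).2 h1)
      have := hsmall k
      have : (3 : ℤ) ≤ p := by exact_mod_cast hp
      omega
    · exact hι0 h1
  have hα0 := hnz hA
  have hβ0 := hnz hB
  have hD' : D.Nondeg QGold.gz := by
    refine D.nondeg_of QGold.gz ?_ ?_
    · intro i i' h
      simp only [hD, Prod.mk.injEq] at h
      obtain ⟨h1, h2⟩ := h
      fin_cases i <;> fin_cases i' <;> simp (decide := true) [hα0, hα0.symm] at h1 h2 ⊢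
    · intro j j' h
      simp only [hD, Prod.mk.injEq] at h
      obtain ⟨h1, h2⟩ := h
      fin_cases j <;> fin_cases j' <;> simp (decide := true) [hβ0, hβ0.symm, ht, ht.symm] at h1 h2 ⊢
  exact ⟨D, hD', indep⟩

/-- **`¬ BoxUseful` from the check and the exact count** (decidable per prime). [folklore] -/
theorem not_boxUseful_of_count [Fact p.Prime] (hp : 3 ≤ p) (zd : ZData) {Emax : ℕ} (hok : zd.OK Emax) (hE : 2 * Emax < p)
    (hbig : 9 * (p * p * (p * p)) ≤ 5 * zd.count p) : ¬ BoxUseful (ZetaCyc p) := by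
  haveI : NeZero p := ⟨(Fact.out : p.Prime).ne_zero⟩
  obtain ⟨D, hD, indep⟩ := exists_indep hp zd hok hE
  refine D.not_boxUseful_of_pattern QGold.gz hD indep ?_
  obtain ⟨-, -, -, hP, -, -⟩ := hok
  rw [ZetaRing.card, card_blockArcSet hP]
  exact hbig

/-- **`¬ BoxUseful` from the check and the UNIFORM count** `144 p⁴ ≤ 5·MIS·(p − 5)⁴` (all trims `lo + hi ≤ 4`, `p ≥ 5`). [folklore] -/
theorem not_boxUseful_of_unif [Fact p.Prime] (hp : 5 ≤ p) (zd : ZData) {Emax : ℕ} (hok : zd.OK Emax) (hE : 2 * Emax < p)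
    (htrim : ∀ c, ∀ φ ∈ zd.P c, ∀ k, cmp k (zd.lo c φ) + cmp k (zd.hi c φ) ≤ 4)
    (hunif : 144 * (p : ℤ) ^ 4 ≤ 5 * zd.MIS * ((p : ℤ) - 5) ^ 4) : ¬ BoxUseful (ZetaCyc p) := by
  refine not_boxUseful_of_count (by omega) zd hok hE ?_
  obtain ⟨A, B, t, P, lo, hi⟩ := zd
  dsimp only at htrim hunif ⊢
  simp only [ZData.count, ZData.MIS] at hunif ⊢
  have hp5 : (5 : ℤ) ≤ p := by exact_mod_cast hp
  -- per block: `16 · blkCount ≥ (p − 5)⁴`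
  have hlen : ∀ (φk : ℤ) (l h : ℕ), l + h ≤ 4 → (p : ℤ) - 5 ≤ 2 * ((bLen2 p φk l h).toNat : ℤ) := by
    intro φk l h hlh
    have e1 := two_mul_bLen2_ge (p := p) φk l h
    have t1 : bLen2 p φk l h ≤ ((bLen2 p φk l h).toNat : ℤ) := Int.self_le_toNat _
    have : ((l : ℕ) : ℤ) + h ≤ 4 := by exact_mod_cast hlh
    linarith
  have hblock : ∀ c, ∀ φ ∈ P c, ((p : ℤ) - 5) ^ 4 ≤ 16 * ((blkCount p φ (lo c φ) (hi c φ) : ℕ) : ℤ) := by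
    intro c φ hφ
    have g0 := hlen φ.1 (lo c φ).1 (hi c φ).1 (htrim c φ hφ 0)
    have g1 := hlen φ.2.1 (lo c φ).2.1 (hi c φ).2.1 (htrim c φ hφ 1)
    have g2 := hlen φ.2.2.1 (lo c φ).2.2.1 (hi c φ).2.2.1 (htrim c φ hφ 2)
    have g3 := hlen φ.2.2.2 (lo c φ).2.2.2 (hi c φ).2.2.2 (htrim c φ hφ 3)
    simp only [blkCount]
    push_cast
    have hq : 0 ≤ (p : ℤ) - 5 := by linarith
    have m01 := mul_le_mul g0 g1 hq (by positivity)
    have m012 := mul_le_mul m01 g2 hq (by positivity)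
    have m0123 := mul_le_mul m012 g3 hq (by positivity)
    nlinarith [m0123]
  have htot : ((∑ c, #(P c) : ℕ) : ℤ) * ((p : ℤ) - 5) ^ 4 ≤
      16 * ((∑ c, ∑ φ ∈ P c, blkCount p φ (lo c φ) (hi c φ) : ℕ) : ℤ) := by
    rw [Nat.cast_sum, Nat.cast_sum, Finset.sum_mul, Finset.mul_sum]
    refine Finset.sum_le_sum fun c _ => ?_
    rw [Nat.cast_sum, Finset.mul_sum]
    have : (#(P c) : ℤ) * ((p : ℤ) - 5) ^ 4 = ∑ φ ∈ P c, ((p : ℤ) - 5) ^ 4 := by rw [Finset.sum_const, nsmul_eq_mul]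
    rw [this]
    exact Finset.sum_le_sum fun φ hφ => hblock c φ hφ
  have h4 : (p : ℤ) ^ 4 = p * p * (p * p) := by ring
  have hfin : 9 * ((p : ℤ) * p * (p * p)) ≤ 5 * ((∑ c, ∑ φ ∈ P c, blkCount p φ (lo c φ) (hi c φ) : ℕ) : ℤ) := by
    nlinarith [htot, hunif, h4]
  exact_mod_cast hfin

end ZetaArcs

end Summit.MatrixMultiplication.OmegaCensus
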